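import Summits.ResolutionOfSingularities.ResolutionOfSingularities.Theorems.FrobeniusLadderFInjectiveMacaulayficationTauFloorOneNotFull
import Summits.ResolutionOfSingularities.ResolutionOfSingularities.Theorems.FrobeniusLadderFInjectiveMacaulayficationTauCentreCharts
import Summits.ResolutionOfSingularities.ResolutionOfSingularities.Theorems.FrobeniusLadderFInjectiveMacaulayficationFCentreE1ChartPresentation
import Literature.AlgebraicGeometry.Resolution.AffineBlowupAlgebra
import HarnessLib

/-!
# F4POS-1 (d-C′): the principal chart ring `C′` IS the Rees chart `D(x̄²)` of `Bl_τ(P2d4C)`: `C′ ≃+* A₀[τ/x̄²] = blowupAlgebra τ x̄²`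
# (crux `FInjectiveMacaulayfication` stmt-ResolutionOfSingularities-15315, chain w45a; res-L1-w45a-plan-1 R18.17 (b)/R18.18 «F4POS-1 (d): … the missing Rees-chart
# identification … and the chart D(x²) ≃ stub-2's C′»; the `D(x̄²)` twin of res-L1-w45a-stub-1's `…TauFloorOneCIChartDomain` (p619693) + `…TauFloorOneCIChartIdent`
# (p620521), same method; seat res-L1-w45a-stub-2 g8)

[OURS · L1 W4.5a] Support file (`--supports stmt-ResolutionOfSingularities-15315 --as helper`); def-free, unconditional; replaces the role of NO printed item;
NOT a statement of the manuscript; AI-written (AI review is weaker than expert review).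

`A₀ = k[X₀..X₄]/(f)`, `f = X₄² + X₀⁴X₄ + X₁³ + X₂³ + X₃³` (P2d4C), `τ = (x̄², ȳ, ū, t̄, z̄)` (res-L1-w45a-stub-3's p618085 spelling
`Ideal.span {mk X₀ ^ 2, mk X₁, mk X₂, mk X₃, mk X₄}`), `C′ = k[X₀..X₄]/(F′)`, `F′ = X₄² + X₀²X₄ + X₀²(X₁³+X₂³+X₃³)` (the ring of `…TauFloorOneNotFull` p615290 /
`…TauCentreCharts` p616615 / `…TauCentreBlowupFull` p617159: `X₀ = x`, `X₁..X₃ = y/x², u/x², t/x²`, `X₄ = z′ = z/x²`).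
* §1 ★ `exists_chartMap` — the chart map `φ′ : C′ → A₀[1/x̄²]`: `X₀ ↦ x̄`, `Xⱼ ↦ X̄ⱼ·(x̄²)⁻¹` (`j = 1..4`); `F′ ↦ f/x̄⁴ = 0` (one ring identity);
* §2 ★ `exists_blowdownMap` — `ψ′ : A₀ → C′`: `X₀ ↦ x̄`, `Xⱼ ↦ X̄ⱼ·x̄²`; `f ↦ x̄⁴·F̄′ = 0`;
* §3 ★ `chartMap_injective` — `ψ′` extended to `A₀[1/x̄²] → C′[1/x̄²]` inverts `φ′` after `C′ → C′[1/x̄²]`, which is injective because `x̄` (hence `x̄²`) is a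
  non-zero-divisor of `C′` (`TauFloorOneNotFull.mk_X0_mem_nonZeroDivisors`, any field);
* §4 ★★ `exists_chartEquiv` — `∃ e : C′ ≃+* blowupAlgebra τ (x̄²), ∀ j, (e (mk Xⱼ) : A₀[1/x̄²]) = (x, y/x², u/x², t/x², z/x²)ⱼ` (Görtz–Wedhorn (13.19): range `⊆` on
  generators by `div_mem_blowupAlgebra`, `⊇` because the range is an `A₀`-subalgebra containing `g/x̄²` for `g ∈ τ`, `Algebra.adjoin_le`); `isDomain_blowupAlgebra`.
With res-L1-w45a-stub-1's `D(ȳ)` (and `D(ū)`, `D(t̄)` by the symmetry `y ↔ u ↔ t`) these four charts COVER the closed fibre of `Bl_τ X → Spec 𝒪_{X,v}` (`D(z̄)` misses it,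
res-L1-w45a-stub-1 l.79878), so every chart-level F4POS-1 fact (non-FULL locus p615290/p617516, FULL cure p617159, CM p617990) transports to `Bl_τ X`. Any field `k`
(no characteristic hypothesis is used). [cite: GortzWedhorn2020, (13.19) p. 415; StacksProject, Tag 0804]
-/

-- single-problem summit: the doubled namespace component is forced
set_option linter.dupNamespace false

noncomputable section

namespace Summit.ResolutionOfSingularities.ResolutionOfSingularities.Theorems.FInjectiveMacaulayfication.TauFloorOneXChartIdent

open MvPolynomial IsLocalization Literature.AlgebraicGeometry.Resolution
open Summit.ResolutionOfSingularities.ResolutionOfSingularities.Theorems.FInjectiveMacaulayfication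

variable (k : Type) [Field k]

/-! ## §1 The chart map `C′ → A₀[1/x̄²]` -/

set_option synthInstance.maxHeartbeats 200000 in
set_option maxHeartbeats 1600000 in
-- instance search on `Localization.Away` over the quotient ring is slow; the proof itself is one ring identity
/-- ★ **The chart map** `φ′ : C′ → A₀[1/x̄²]`: `X₀ ↦ x`, `X₁ ↦ y/x²`, `X₂ ↦ u/x²`, `X₃ ↦ t/x²`, `X₄ ↦ z/x²` (`F′ ↦ x⁻⁴·f = 0`). [folklore] -/
theorem exists_chartMap (f : MvPolynomial (Fin 5) k) (hf : f = X 4 ^ 2 + X 0 ^ 4 * X 4 + X 1 ^ 3 + X 2 ^ 3 + X 3 ^ 3)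
    (F' : MvPolynomial (Fin 5) k) (hF : F' = X 4 ^ 2 + X 0 ^ 2 * X 4 + X 0 ^ 2 * (X 1 ^ 3 + X 2 ^ 3 + X 3 ^ 3)) :
    ∃ φ : (MvPolynomial (Fin 5) k ⧸ Ideal.span {F'}) →+*
        Localization.Away (Ideal.Quotient.mk (Ideal.span {f}) (X 0) ^ 2 : MvPolynomial (Fin 5) k ⧸ Ideal.span {f}),
      (∀ j : Fin 5, φ (Ideal.Quotient.mk (Ideal.span {F'}) (X j)) =
        ![algebraMap (MvPolynomial (Fin 5) k ⧸ Ideal.span {f}) (Localization.Away (Ideal.Quotient.mk (Ideal.span {f}) (X 0) ^ 2 : MvPolynomial (Fin 5) k ⧸ Ideal.span {f})) (Ideal.Quotient.mk (Ideal.span {f}) (X 0)),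
          algebraMap (MvPolynomial (Fin 5) k ⧸ Ideal.span {f}) (Localization.Away (Ideal.Quotient.mk (Ideal.span {f}) (X 0) ^ 2 : MvPolynomial (Fin 5) k ⧸ Ideal.span {f})) (Ideal.Quotient.mk (Ideal.span {f}) (X 1)) * Away.invSelf (Ideal.Quotient.mk (Ideal.span {f}) (X 0) ^ 2),
          algebraMap (MvPolynomial (Fin 5) k ⧸ Ideal.span {f}) (Localization.Away (Ideal.Quotient.mk (Ideal.span {f}) (X 0) ^ 2 : MvPolynomial (Fin 5) k ⧸ Ideal.span {f})) (Ideal.Quotient.mk (Ideal.span {f}) (X 2)) * Away.invSelf (Ideal.Quotient.mk (Ideal.span {f}) (X 0) ^ 2),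
          algebraMap (MvPolynomial (Fin 5) k ⧸ Ideal.span {f}) (Localization.Away (Ideal.Quotient.mk (Ideal.span {f}) (X 0) ^ 2 : MvPolynomial (Fin 5) k ⧸ Ideal.span {f})) (Ideal.Quotient.mk (Ideal.span {f}) (X 3)) * Away.invSelf (Ideal.Quotient.mk (Ideal.span {f}) (X 0) ^ 2),
          algebraMap (MvPolynomial (Fin 5) k ⧸ Ideal.span {f}) (Localization.Away (Ideal.Quotient.mk (Ideal.span {f}) (X 0) ^ 2 : MvPolynomial (Fin 5) k ⧸ Ideal.span {f})) (Ideal.Quotient.mk (Ideal.span {f}) (X 4)) * Away.invSelf (Ideal.Quotient.mk (Ideal.span {f}) (X 0) ^ 2)] j) ∧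
      (∀ a : k, φ (Ideal.Quotient.mk (Ideal.span {F'}) (C a)) =
        algebraMap (MvPolynomial (Fin 5) k ⧸ Ideal.span {f}) (Localization.Away (Ideal.Quotient.mk (Ideal.span {f}) (X 0) ^ 2 : MvPolynomial (Fin 5) k ⧸ Ideal.span {f})) (Ideal.Quotient.mk (Ideal.span {f}) (C a))) := by
  -- the two relations in `L = A₀[1/x̄²]`, then generalize the six atoms (keeps `ring` cheap)
  have hxi : algebraMap (MvPolynomial (Fin 5) k ⧸ Ideal.span {f}) (Localization.Away (Ideal.Quotient.mk (Ideal.span {f}) (X 0) ^ 2 :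
      MvPolynomial (Fin 5) k ⧸ Ideal.span {f})) (Ideal.Quotient.mk (Ideal.span {f}) (X 0)) ^ 2 * Away.invSelf (Ideal.Quotient.mk (Ideal.span {f}) (X 0) ^ 2) = 1 := by
    have h := Away.mul_invSelf (S := Localization.Away (Ideal.Quotient.mk (Ideal.span {f}) (X 0) ^ 2 : MvPolynomial (Fin 5) k ⧸ Ideal.span {f}))
      (Ideal.Quotient.mk (Ideal.span {f}) (X 0) ^ 2 : MvPolynomial (Fin 5) k ⧸ Ideal.span {f})
    rwa [map_pow] at h
  have hF0 : algebraMap (MvPolynomial (Fin 5) k ⧸ Ideal.span {f}) (Localization.Away (Ideal.Quotient.mk (Ideal.span {f}) (X 0) ^ 2 :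
      MvPolynomial (Fin 5) k ⧸ Ideal.span {f})) (Ideal.Quotient.mk (Ideal.span {f}) (X 4)) ^ 2 +
      algebraMap (MvPolynomial (Fin 5) k ⧸ Ideal.span {f}) (Localization.Away (Ideal.Quotient.mk (Ideal.span {f}) (X 0) ^ 2 : MvPolynomial (Fin 5) k ⧸ Ideal.span {f})) (Ideal.Quotient.mk (Ideal.span {f}) (X 0)) ^ 4 * algebraMap (MvPolynomial (Fin 5) k ⧸ Ideal.span {f}) (Localization.Away (Ideal.Quotient.mk (Ideal.span {f}) (X 0) ^ 2 : MvPolynomial (Fin 5) k ⧸ Ideal.span {f})) (Ideal.Quotient.mk (Ideal.span {f}) (X 4)) +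
      algebraMap (MvPolynomial (Fin 5) k ⧸ Ideal.span {f}) (Localization.Away (Ideal.Quotient.mk (Ideal.span {f}) (X 0) ^ 2 : MvPolynomial (Fin 5) k ⧸ Ideal.span {f})) (Ideal.Quotient.mk (Ideal.span {f}) (X 1)) ^ 3 + algebraMap (MvPolynomial (Fin 5) k ⧸ Ideal.span {f}) (Localization.Away (Ideal.Quotient.mk (Ideal.span {f}) (X 0) ^ 2 : MvPolynomial (Fin 5) k ⧸ Ideal.span {f})) (Ideal.Quotient.mk (Ideal.span {f}) (X 2)) ^ 3 +
      algebraMap (MvPolynomial (Fin 5) k ⧸ Ideal.span {f}) (Localization.Away (Ideal.Quotient.mk (Ideal.span {f}) (X 0) ^ 2 : MvPolynomial (Fin 5) k ⧸ Ideal.span {f})) (Ideal.Quotient.mk (Ideal.span {f}) (X 3)) ^ 3 = 0 := by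
    have h0 : Ideal.Quotient.mk (Ideal.span {f}) (X 4 ^ 2 + X 0 ^ 4 * X 4 + X 1 ^ 3 + X 2 ^ 3 + X 3 ^ 3) = 0 := by
      rw [← hf]; exact Ideal.Quotient.eq_zero_iff_mem.mpr (Ideal.mem_span_singleton_self f)
    have := congrArg (algebraMap (MvPolynomial (Fin 5) k ⧸ Ideal.span {f})
      (Localization.Away (Ideal.Quotient.mk (Ideal.span {f}) (X 0) ^ 2 : MvPolynomial (Fin 5) k ⧸ Ideal.span {f}))) h0
    simpa only [map_add, map_mul, map_pow, map_zero] using this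
  have hCa : ∀ a : k, algebraMap k (Localization.Away (Ideal.Quotient.mk (Ideal.span {f}) (X 0) ^ 2 : MvPolynomial (Fin 5) k ⧸ Ideal.span {f})) a =
      algebraMap (MvPolynomial (Fin 5) k ⧸ Ideal.span {f}) (Localization.Away (Ideal.Quotient.mk (Ideal.span {f}) (X 0) ^ 2 : MvPolynomial (Fin 5) k ⧸ Ideal.span {f})) (Ideal.Quotient.mk (Ideal.span {f}) (C a)) := fun a => by
    rw [IsScalarTower.algebraMap_apply k (MvPolynomial (Fin 5) k ⧸ Ideal.span {f})]; rfl
  generalize (Away.invSelf (Ideal.Quotient.mk (Ideal.span {f}) (X 0) ^ 2 : MvPolynomial (Fin 5) k ⧸ Ideal.span {f}) :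
    Localization.Away (Ideal.Quotient.mk (Ideal.span {f}) (X 0) ^ 2 : MvPolynomial (Fin 5) k ⧸ Ideal.span {f})) = i at hxi ⊢
  generalize algebraMap (MvPolynomial (Fin 5) k ⧸ Ideal.span {f}) (Localization.Away (Ideal.Quotient.mk (Ideal.span {f}) (X 0) ^ 2 :
      MvPolynomial (Fin 5) k ⧸ Ideal.span {f})) (Ideal.Quotient.mk (Ideal.span {f}) (X 0)) = a0 at hF0 hxi ⊢
  generalize algebraMap (MvPolynomial (Fin 5) k ⧸ Ideal.span {f}) (Localization.Away (Ideal.Quotient.mk (Ideal.span {f}) (X 0) ^ 2 :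
      MvPolynomial (Fin 5) k ⧸ Ideal.span {f})) (Ideal.Quotient.mk (Ideal.span {f}) (X 1)) = a1 at hF0 ⊢
  generalize algebraMap (MvPolynomial (Fin 5) k ⧸ Ideal.span {f}) (Localization.Away (Ideal.Quotient.mk (Ideal.span {f}) (X 0) ^ 2 :
      MvPolynomial (Fin 5) k ⧸ Ideal.span {f})) (Ideal.Quotient.mk (Ideal.span {f}) (X 2)) = a2 at hF0 ⊢
  generalize algebraMap (MvPolynomial (Fin 5) k ⧸ Ideal.span {f}) (Localization.Away (Ideal.Quotient.mk (Ideal.span {f}) (X 0) ^ 2 :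
      MvPolynomial (Fin 5) k ⧸ Ideal.span {f})) (Ideal.Quotient.mk (Ideal.span {f}) (X 3)) = a3 at hF0 ⊢
  generalize algebraMap (MvPolynomial (Fin 5) k ⧸ Ideal.span {f}) (Localization.Away (Ideal.Quotient.mk (Ideal.span {f}) (X 0) ^ 2 :
      MvPolynomial (Fin 5) k ⧸ Ideal.span {f})) (Ideal.Quotient.mk (Ideal.span {f}) (X 4)) = a4 at hF0 ⊢
  -- the substitution
  let v : Fin 5 → Localization.Away (Ideal.Quotient.mk (Ideal.span {f}) (X 0) ^ 2 : MvPolynomial (Fin 5) k ⧸ Ideal.span {f}) :=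
    ![a0, a1 * i, a2 * i, a3 * i, a4 * i]
  have hv0 : v 0 = a0 := rfl
  have hv1 : v 1 = a1 * i := rfl
  have hv2 : v 2 = a2 * i := rfl
  have hv3 : v 3 = a3 * i := rfl
  have hv4 : v 4 = a4 * i := rfl
  have hφF : aeval v F' = 0 := by
    rw [hF]
    simp only [map_add, map_mul, map_pow, aeval_X, hv0, hv1, hv2, hv3, hv4]
    linear_combination (i ^ 2) * hF0 + ((a1 ^ 3 + a2 ^ 3 + a3 ^ 3) * i ^ 2 - a0 ^ 2 * a4 * i) * hxi
  have hker : ∀ a ∈ Ideal.span {F'}, (aeval v).toRingHom a = 0 := by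
    intro a ha
    obtain ⟨c, rfl⟩ := Ideal.mem_span_singleton.mp ha
    rw [AlgHom.toRingHom_eq_coe, RingHom.coe_coe, map_mul, hφF, zero_mul]
  refine ⟨Ideal.Quotient.lift (Ideal.span {F'}) (aeval v).toRingHom hker, fun j => ?_, fun a => ?_⟩
  · rw [Ideal.Quotient.lift_mk, AlgHom.toRingHom_eq_coe, RingHom.coe_coe, aeval_X]
  · rw [Ideal.Quotient.lift_mk, AlgHom.toRingHom_eq_coe, RingHom.coe_coe, aeval_C, hCa]

/-! ## §2 The blow-down map `A₀ → C′` -/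

/-- ★ **The blow-down map** `ψ′ : A₀ → C′`: `X₀ ↦ x̄`, `Xⱼ ↦ X̄ⱼ·x̄²` (`j = 1..4`); `f ↦ x̄⁴·F̄′ = 0`. [folklore] -/
theorem exists_blowdownMap (f : MvPolynomial (Fin 5) k) (hf : f = X 4 ^ 2 + X 0 ^ 4 * X 4 + X 1 ^ 3 + X 2 ^ 3 + X 3 ^ 3)
    (F' : MvPolynomial (Fin 5) k) (hF : F' = X 4 ^ 2 + X 0 ^ 2 * X 4 + X 0 ^ 2 * (X 1 ^ 3 + X 2 ^ 3 + X 3 ^ 3)) :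
    ∃ ψ₁ : (MvPolynomial (Fin 5) k ⧸ Ideal.span {f}) →+* (MvPolynomial (Fin 5) k ⧸ Ideal.span {F'}),
      (∀ j : Fin 5, ψ₁ (Ideal.Quotient.mk (Ideal.span {f}) (X j)) =
        ![Ideal.Quotient.mk (Ideal.span {F'}) (X 0),
          Ideal.Quotient.mk (Ideal.span {F'}) (X 1) * Ideal.Quotient.mk (Ideal.span {F'}) (X 0) ^ 2,
          Ideal.Quotient.mk (Ideal.span {F'}) (X 2) * Ideal.Quotient.mk (Ideal.span {F'}) (X 0) ^ 2,
          Ideal.Quotient.mk (Ideal.span {F'}) (X 3) * Ideal.Quotient.mk (Ideal.span {F'}) (X 0) ^ 2,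
          Ideal.Quotient.mk (Ideal.span {F'}) (X 4) * Ideal.Quotient.mk (Ideal.span {F'}) (X 0) ^ 2] j) ∧
      (∀ a : k, ψ₁ (Ideal.Quotient.mk (Ideal.span {f}) (C a)) = Ideal.Quotient.mk (Ideal.span {F'}) (C a)) := by
  set mkC : MvPolynomial (Fin 5) k →+* MvPolynomial (Fin 5) k ⧸ Ideal.span {F'} := Ideal.Quotient.mk (Ideal.span {F'}) with hmkC
  set w : Fin 5 → MvPolynomial (Fin 5) k ⧸ Ideal.span {F'} :=
    ![mkC (X 0), mkC (X 1) * mkC (X 0) ^ 2, mkC (X 2) * mkC (X 0) ^ 2, mkC (X 3) * mkC (X 0) ^ 2, mkC (X 4) * mkC (X 0) ^ 2] with hw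
  have hF0 : mkC (X 4) ^ 2 + mkC (X 0) ^ 2 * mkC (X 4) + mkC (X 0) ^ 2 * (mkC (X 1) ^ 3 + mkC (X 2) ^ 3 + mkC (X 3) ^ 3) = 0 := by
    have h0 : mkC (X 4 ^ 2 + X 0 ^ 2 * X 4 + X 0 ^ 2 * (X 1 ^ 3 + X 2 ^ 3 + X 3 ^ 3)) = 0 :=
      Ideal.Quotient.eq_zero_iff_mem.mpr (by rw [← hF]; exact Ideal.mem_span_singleton_self F')
    simpa only [map_add, map_mul, map_pow] using h0
  have hw0 : w 0 = mkC (X 0) := rfl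
  have hw1 : w 1 = mkC (X 1) * mkC (X 0) ^ 2 := rfl
  have hw2 : w 2 = mkC (X 2) * mkC (X 0) ^ 2 := rfl
  have hw3 : w 3 = mkC (X 3) * mkC (X 0) ^ 2 := rfl
  have hw4 : w 4 = mkC (X 4) * mkC (X 0) ^ 2 := rfl
  have hψf : aeval w f = 0 := by
    rw [hf]
    simp only [map_add, map_mul, map_pow, aeval_X, hw0, hw1, hw2, hw3, hw4]
    linear_combination (mkC (X 0)) ^ 4 * hF0
  have hker : ∀ a ∈ Ideal.span {f}, (aeval w).toRingHom a = 0 := by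
    intro a ha
    obtain ⟨c, rfl⟩ := Ideal.mem_span_singleton.mp ha
    rw [AlgHom.toRingHom_eq_coe, RingHom.coe_coe, map_mul, hψf, zero_mul]
  refine ⟨Ideal.Quotient.lift (Ideal.span {f}) (aeval w).toRingHom hker, fun j => ?_, fun a => ?_⟩
  · rw [Ideal.Quotient.lift_mk, AlgHom.toRingHom_eq_coe, RingHom.coe_coe, aeval_X]
  · rw [Ideal.Quotient.lift_mk, AlgHom.toRingHom_eq_coe, RingHom.coe_coe, aeval_C]
    rfl

/-! ## §3 The chart map is injective -/

set_option synthInstance.maxHeartbeats 200000 in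
set_option maxHeartbeats 1600000 in
-- one `IsLocalization` lift + a generator-by-generator comparison of two ring maps out of a quotient of `k[X₀..X₄]`
/-- ★ **The chart map is injective**: the blow-down map, extended to `A₀[1/x̄²] → C′[1/x̄²]`, composed with `φ′` is the localisation map `C′ → C′[1/x̄²]`
(check on generators: e.g. `X₄ ↦ z/x² ↦ z̄′x̄²/x̄² = z̄′`), and `C′ → C′[1/x̄²]` is injective because `x̄` is a non-zero-divisor
(`TauFloorOneNotFull.mk_X0_mem_nonZeroDivisors`). [folklore] -/
theorem chartMap_injective (f : MvPolynomial (Fin 5) k) (hf : f = X 4 ^ 2 + X 0 ^ 4 * X 4 + X 1 ^ 3 + X 2 ^ 3 + X 3 ^ 3)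
    (F' : MvPolynomial (Fin 5) k) (hF : F' = X 4 ^ 2 + X 0 ^ 2 * X 4 + X 0 ^ 2 * (X 1 ^ 3 + X 2 ^ 3 + X 3 ^ 3))
    (φ : (MvPolynomial (Fin 5) k ⧸ Ideal.span {F'}) →+*
        Localization.Away (Ideal.Quotient.mk (Ideal.span {f}) (X 0) ^ 2 : MvPolynomial (Fin 5) k ⧸ Ideal.span {f}))
    (hφX : ∀ j : Fin 5, φ (Ideal.Quotient.mk (Ideal.span {F'}) (X j)) =
        ![algebraMap (MvPolynomial (Fin 5) k ⧸ Ideal.span {f}) (Localization.Away (Ideal.Quotient.mk (Ideal.span {f}) (X 0) ^ 2 : MvPolynomial (Fin 5) k ⧸ Ideal.span {f})) (Ideal.Quotient.mk (Ideal.span {f}) (X 0)),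
          algebraMap (MvPolynomial (Fin 5) k ⧸ Ideal.span {f}) (Localization.Away (Ideal.Quotient.mk (Ideal.span {f}) (X 0) ^ 2 : MvPolynomial (Fin 5) k ⧸ Ideal.span {f})) (Ideal.Quotient.mk (Ideal.span {f}) (X 1)) * Away.invSelf (Ideal.Quotient.mk (Ideal.span {f}) (X 0) ^ 2),
          algebraMap (MvPolynomial (Fin 5) k ⧸ Ideal.span {f}) (Localization.Away (Ideal.Quotient.mk (Ideal.span {f}) (X 0) ^ 2 : MvPolynomial (Fin 5) k ⧸ Ideal.span {f})) (Ideal.Quotient.mk (Ideal.span {f}) (X 2)) * Away.invSelf (Ideal.Quotient.mk (Ideal.span {f}) (X 0) ^ 2),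
          algebraMap (MvPolynomial (Fin 5) k ⧸ Ideal.span {f}) (Localization.Away (Ideal.Quotient.mk (Ideal.span {f}) (X 0) ^ 2 : MvPolynomial (Fin 5) k ⧸ Ideal.span {f})) (Ideal.Quotient.mk (Ideal.span {f}) (X 3)) * Away.invSelf (Ideal.Quotient.mk (Ideal.span {f}) (X 0) ^ 2),
          algebraMap (MvPolynomial (Fin 5) k ⧸ Ideal.span {f}) (Localization.Away (Ideal.Quotient.mk (Ideal.span {f}) (X 0) ^ 2 : MvPolynomial (Fin 5) k ⧸ Ideal.span {f})) (Ideal.Quotient.mk (Ideal.span {f}) (X 4)) * Away.invSelf (Ideal.Quotient.mk (Ideal.span {f}) (X 0) ^ 2)] j)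
    (hφC : ∀ a : k, φ (Ideal.Quotient.mk (Ideal.span {F'}) (C a)) =
        algebraMap (MvPolynomial (Fin 5) k ⧸ Ideal.span {f}) (Localization.Away (Ideal.Quotient.mk (Ideal.span {f}) (X 0) ^ 2 : MvPolynomial (Fin 5) k ⧸ Ideal.span {f})) (Ideal.Quotient.mk (Ideal.span {f}) (C a))) :
    Function.Injective φ := by
  classical
  let mkA : MvPolynomial (Fin 5) k →+* MvPolynomial (Fin 5) k ⧸ Ideal.span {f} := Ideal.Quotient.mk (Ideal.span {f})
  let mkC : MvPolynomial (Fin 5) k →+* MvPolynomial (Fin 5) k ⧸ Ideal.span {F'} := Ideal.Quotient.mk (Ideal.span {F'})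
  let ιC : (MvPolynomial (Fin 5) k ⧸ Ideal.span {F'}) →+* Localization.Away (mkC (X 0) ^ 2) := algebraMap _ _
  -- `C′ → C′[1/x̄²]` is injective (`x̄²` is a non-zero-divisor)
  have hιC_inj : Function.Injective ιC :=
    IsLocalization.injective (Localization.Away (mkC (X 0) ^ 2)) (M := Submonoid.powers (mkC (X 0) ^ 2))
      ((Submonoid.powers_le (P := nonZeroDivisors _)).mpr
        (pow_mem (TauFloorOneNotFull.mk_X0_mem_nonZeroDivisors k F' hF) 2))
  -- the blow-down map and its extension `ψ : A₀[1/x̄²] → C′[1/x̄²]`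
  obtain ⟨ψ₁, hψX, hψC⟩ := exists_blowdownMap k f hf F' hF
  have hψx2 : ψ₁ (mkA (X 0) ^ 2) = mkC (X 0) ^ 2 := by rw [map_pow]; exact congrArg (· ^ 2) (hψX 0)
  have hunit : IsUnit ((ιC.comp ψ₁) (mkA (X 0) ^ 2)) := by
    rw [RingHom.comp_apply, hψx2]
    exact IsLocalization.Away.algebraMap_isUnit (mkC (X 0) ^ 2)
  let ψ : Localization.Away (mkA (X 0) ^ 2) →+* Localization.Away (mkC (X 0) ^ 2) := IsLocalization.Away.lift (mkA (X 0) ^ 2) hunit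
  have hψι : ∀ a, ψ (algebraMap _ (Localization.Away (mkA (X 0) ^ 2)) a) = ιC (ψ₁ a) := fun a =>
    IsLocalization.Away.lift_eq (mkA (X 0) ^ 2) hunit a
  -- `ψ ∘ φ = ιC`
  have hxu : IsUnit (ιC (mkC (X 0) ^ 2)) := IsLocalization.Away.algebraMap_isUnit (mkC (X 0) ^ 2)
  have hψi : ψ (Away.invSelf (mkA (X 0) ^ 2)) * ιC (mkC (X 0) ^ 2) = 1 := by
    have h1 : ψ (Away.invSelf (mkA (X 0) ^ 2)) * ψ (algebraMap _ (Localization.Away (mkA (X 0) ^ 2)) (mkA (X 0) ^ 2)) = 1 := by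
      rw [← map_mul, mul_comm, Away.mul_invSelf, map_one]
    rwa [hψι, hψx2] at h1
  have hgen : ∀ j : Fin 5, j ≠ 0 →
      ψ (algebraMap _ (Localization.Away (mkA (X 0) ^ 2)) (mkA (X j)) * Away.invSelf (mkA (X 0) ^ 2)) = ιC (mkC (X j)) := by
    intro j hj
    rw [map_mul, hψι, hψX]
    apply hxu.mul_left_injective
    have hwj : (![mkC (X 0), mkC (X 1) * mkC (X 0) ^ 2, mkC (X 2) * mkC (X 0) ^ 2, mkC (X 3) * mkC (X 0) ^ 2,
        mkC (X 4) * mkC (X 0) ^ 2] : Fin 5 → MvPolynomial (Fin 5) k ⧸ Ideal.span {F'}) j = mkC (X j) * mkC (X 0) ^ 2 := by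
      fin_cases j
      · exact absurd rfl hj
      all_goals rfl
    change ιC (![mkC (X 0), mkC (X 1) * mkC (X 0) ^ 2, mkC (X 2) * mkC (X 0) ^ 2, mkC (X 3) * mkC (X 0) ^ 2,
        mkC (X 4) * mkC (X 0) ^ 2] j) * ψ (Away.invSelf (mkA (X 0) ^ 2)) * ιC (mkC (X 0) ^ 2) = ιC (mkC (X j)) * ιC (mkC (X 0) ^ 2)
    rw [hwj, mul_assoc, hψi, mul_one, map_mul]
  have hcomp : ψ.comp φ = ιC := by
    refine Ideal.Quotient.ringHom_ext (MvPolynomial.ringHom_ext (fun a => ?_) (fun j => ?_))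
    · change ψ (φ (mkC (C a))) = ιC (mkC (C a))
      rw [hφC, hψι, hψC]
    · change ψ (φ (mkC (X j))) = ιC (mkC (X j))
      rw [hφX]
      fin_cases j
      · simp only [Fin.zero_eta, Fin.isValue, Matrix.cons_val_zero]
        rw [hψι, hψX]; rfl
      · exact hgen 1 (by decide)
      · exact hgen 2 (by decide)
      · exact hgen 3 (by decide)
      · exact hgen 4 (by decide)
  have h2 : Function.Injective (⇑ψ ∘ ⇑φ) := by rw [← RingHom.coe_comp, hcomp]; exact hιC_inj
  exact h2.of_comp

/-! ## §4 ★★ `C′ ≃ A₀[τ/x̄²]` -/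

set_option synthInstance.maxHeartbeats 200000 in
set_option maxHeartbeats 1600000 in
-- instance search on `Localization.Away` over the quotient ring is slow (as in `…TauFloorOneCIChartIdent`)
/-- ★★ **The principal chart ring `C′` is the Rees chart `D(x̄²)` of `Bl_τ X`**: a ring isomorphism `C′ ≃+* blowupAlgebra τ (x̄²)` over `A₀[1/x̄²]` sending
`X₀, X₁, X₂, X₃, X₄ ↦ x, y/x², u/x², t/x², z/x²`. [cite: GortzWedhorn2020, (13.19)] -/
theorem exists_chartEquiv (f : MvPolynomial (Fin 5) k) (hf : f = X 4 ^ 2 + X 0 ^ 4 * X 4 + X 1 ^ 3 + X 2 ^ 3 + X 3 ^ 3)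
    (F' : MvPolynomial (Fin 5) k) (hF : F' = X 4 ^ 2 + X 0 ^ 2 * X 4 + X 0 ^ 2 * (X 1 ^ 3 + X 2 ^ 3 + X 3 ^ 3)) :
    ∃ e : (MvPolynomial (Fin 5) k ⧸ Ideal.span {F'}) ≃+*
        blowupAlgebra (Ideal.span {Ideal.Quotient.mk (Ideal.span {f}) (X 0) ^ 2, Ideal.Quotient.mk (Ideal.span {f}) (X 1),
          Ideal.Quotient.mk (Ideal.span {f}) (X 2), Ideal.Quotient.mk (Ideal.span {f}) (X 3), Ideal.Quotient.mk (Ideal.span {f}) (X 4)} :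
            Ideal (MvPolynomial (Fin 5) k ⧸ Ideal.span {f}))
          (Ideal.Quotient.mk (Ideal.span {f}) (X 0) ^ 2),
      ∀ j : Fin 5, ((e (Ideal.Quotient.mk (Ideal.span {F'}) (X j)) :
          blowupAlgebra _ (Ideal.Quotient.mk (Ideal.span {f}) (X 0) ^ 2)) :
            Localization.Away (Ideal.Quotient.mk (Ideal.span {f}) (X 0) ^ 2 : MvPolynomial (Fin 5) k ⧸ Ideal.span {f})) =
        ![algebraMap (MvPolynomial (Fin 5) k ⧸ Ideal.span {f}) (Localization.Away (Ideal.Quotient.mk (Ideal.span {f}) (X 0) ^ 2 : MvPolynomial (Fin 5) k ⧸ Ideal.span {f})) (Ideal.Quotient.mk (Ideal.span {f}) (X 0)),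
          algebraMap (MvPolynomial (Fin 5) k ⧸ Ideal.span {f}) (Localization.Away (Ideal.Quotient.mk (Ideal.span {f}) (X 0) ^ 2 : MvPolynomial (Fin 5) k ⧸ Ideal.span {f})) (Ideal.Quotient.mk (Ideal.span {f}) (X 1)) * Away.invSelf (Ideal.Quotient.mk (Ideal.span {f}) (X 0) ^ 2),
          algebraMap (MvPolynomial (Fin 5) k ⧸ Ideal.span {f}) (Localization.Away (Ideal.Quotient.mk (Ideal.span {f}) (X 0) ^ 2 : MvPolynomial (Fin 5) k ⧸ Ideal.span {f})) (Ideal.Quotient.mk (Ideal.span {f}) (X 2)) * Away.invSelf (Ideal.Quotient.mk (Ideal.span {f}) (X 0) ^ 2),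
          algebraMap (MvPolynomial (Fin 5) k ⧸ Ideal.span {f}) (Localization.Away (Ideal.Quotient.mk (Ideal.span {f}) (X 0) ^ 2 : MvPolynomial (Fin 5) k ⧸ Ideal.span {f})) (Ideal.Quotient.mk (Ideal.span {f}) (X 3)) * Away.invSelf (Ideal.Quotient.mk (Ideal.span {f}) (X 0) ^ 2),
          algebraMap (MvPolynomial (Fin 5) k ⧸ Ideal.span {f}) (Localization.Away (Ideal.Quotient.mk (Ideal.span {f}) (X 0) ^ 2 : MvPolynomial (Fin 5) k ⧸ Ideal.span {f})) (Ideal.Quotient.mk (Ideal.span {f}) (X 4)) * Away.invSelf (Ideal.Quotient.mk (Ideal.span {f}) (X 0) ^ 2)] j := by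
  classical
  obtain ⟨φ, hφX, hφC⟩ := exists_chartMap k f hf F' hF
  have hinj := chartMap_injective k f hf F' hF φ hφX hφC
  obtain ⟨ψ₁, hψX, hψC⟩ := exists_blowdownMap k f hf F' hF
  -- abbreviations (terms only)
  let mkA : MvPolynomial (Fin 5) k →+* MvPolynomial (Fin 5) k ⧸ Ideal.span {f} := Ideal.Quotient.mk (Ideal.span {f})
  let mkC : MvPolynomial (Fin 5) k →+* MvPolynomial (Fin 5) k ⧸ Ideal.span {F'} := Ideal.Quotient.mk (Ideal.span {F'})
  let τ : Ideal (MvPolynomial (Fin 5) k ⧸ Ideal.span {f}) := Ideal.span {mkA (X 0) ^ 2, mkA (X 1), mkA (X 2), mkA (X 3), mkA (X 4)}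
  let B : Subalgebra (MvPolynomial (Fin 5) k ⧸ Ideal.span {f}) (Localization.Away (mkA (X 0) ^ 2)) := blowupAlgebra τ (mkA (X 0) ^ 2)
  let ι : (MvPolynomial (Fin 5) k ⧸ Ideal.span {f}) →+* Localization.Away (mkA (X 0) ^ 2) := algebraMap _ _
  have hxi : ι (mkA (X 0) ^ 2) * Away.invSelf (mkA (X 0) ^ 2) = 1 := Away.mul_invSelf _
  have hxi' : ι (mkA (X 0)) ^ 2 * Away.invSelf (mkA (X 0) ^ 2) = 1 := by
    have h := hxi
    rwa [map_pow] at h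
  -- (1) `φ ∘ ψ₁ = algebraMap A₀ A₀[1/x̄²]`
  have hgen : ∀ j : Fin 5, j ≠ 0 → φ (mkC (X j) * mkC (X 0) ^ 2) = ι (mkA (X j)) := by
    intro j hj
    rw [map_mul, map_pow, hφX j, hφX 0]
    have hvj : (![ι (mkA (X 0)), ι (mkA (X 1)) * Away.invSelf (mkA (X 0) ^ 2), ι (mkA (X 2)) * Away.invSelf (mkA (X 0) ^ 2),
        ι (mkA (X 3)) * Away.invSelf (mkA (X 0) ^ 2), ι (mkA (X 4)) * Away.invSelf (mkA (X 0) ^ 2)] :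
        Fin 5 → Localization.Away (mkA (X 0) ^ 2)) j = ι (mkA (X j)) * Away.invSelf (mkA (X 0) ^ 2) := by
      fin_cases j
      · exact absurd rfl hj
      all_goals rfl
    change (![ι (mkA (X 0)), ι (mkA (X 1)) * Away.invSelf (mkA (X 0) ^ 2), ι (mkA (X 2)) * Away.invSelf (mkA (X 0) ^ 2),
        ι (mkA (X 3)) * Away.invSelf (mkA (X 0) ^ 2), ι (mkA (X 4)) * Away.invSelf (mkA (X 0) ^ 2)] :
        Fin 5 → Localization.Away (mkA (X 0) ^ 2)) j * (ι (mkA (X 0))) ^ 2 = ι (mkA (X j))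
    rw [hvj, mul_assoc, mul_comm (Away.invSelf _), hxi', mul_one]
  have hφψ : φ.comp ψ₁ = ι := by
    refine Ideal.Quotient.ringHom_ext (MvPolynomial.ringHom_ext (fun a => ?_) (fun j => ?_))
    · change φ (ψ₁ (mkA (C a))) = ι (mkA (C a))
      rw [hψC, hφC]
    · change φ (ψ₁ (mkA (X j))) = ι (mkA (X j))
      rw [hψX]
      fin_cases j
      · exact hφX 0
      · exact hgen 1 (by decide)
      · exact hgen 2 (by decide)
      · exact hgen 3 (by decide)
      · exact hgen 4 (by decide)
  have hι_mem : ∀ a, ι a ∈ φ.range := fun a => ⟨ψ₁ a, by rw [← RingHom.comp_apply, hφψ]⟩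
  -- (2) `range φ ⊆ B`: generators
  have hX_mem : ∀ j : Fin 5, φ (mkC (X j)) ∈ B := by
    intro j
    rw [hφX]
    fin_cases j
    · exact B.algebraMap_mem (mkA (X 0))
    · change ι (mkA (X 1)) * Away.invSelf (mkA (X 0) ^ 2) ∈ B
      exact div_mem_blowupAlgebra τ (mkA (X 0) ^ 2) (Ideal.subset_span (by simp))
    · change ι (mkA (X 2)) * Away.invSelf (mkA (X 0) ^ 2) ∈ B
      exact div_mem_blowupAlgebra τ (mkA (X 0) ^ 2) (Ideal.subset_span (by simp))
    · change ι (mkA (X 3)) * Away.invSelf (mkA (X 0) ^ 2) ∈ B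
      exact div_mem_blowupAlgebra τ (mkA (X 0) ^ 2) (Ideal.subset_span (by simp))
    · change ι (mkA (X 4)) * Away.invSelf (mkA (X 0) ^ 2) ∈ B
      exact div_mem_blowupAlgebra τ (mkA (X 0) ^ 2) (Ideal.subset_span (by simp))
  have hrange_le : ∀ c, φ c ∈ B := by
    intro c
    obtain ⟨q, rfl⟩ := Ideal.Quotient.mk_surjective c
    induction q using MvPolynomial.induction_on with
    | C a => change φ (mkC (C a)) ∈ B; rw [hφC]; exact B.algebraMap_mem _
    | add p q hp hq => rw [map_add, map_add]; exact B.add_mem hp hq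
    | mul_X p j hp => rw [map_mul, map_mul]; exact B.mul_mem hp (hX_mem j)
  -- (3) `B ⊆ range φ`: the range is an `A₀`-subalgebra containing the generators `g/x̄²`, `g ∈ τ`
  let Rφ : Subalgebra (MvPolynomial (Fin 5) k ⧸ Ideal.span {f}) (Localization.Away (mkA (X 0) ^ 2)) :=
    { carrier := φ.range
      mul_mem' := fun ha hb => φ.range.mul_mem ha hb
      one_mem' := φ.range.one_mem
      add_mem' := fun ha hb => φ.range.add_mem ha hb
      zero_mem' := φ.range.zero_mem
      algebraMap_mem' := fun a => hι_mem a }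
  have hgens : blowupAlgebraGens τ (mkA (X 0) ^ 2) ⊆ (Rφ : Set (Localization.Away (mkA (X 0) ^ 2))) := by
    rintro _ ⟨g, hg, rfl⟩
    change ι g * Away.invSelf (mkA (X 0) ^ 2) ∈ φ.range
    refine Submodule.span_induction (p := fun g _ => ι g * Away.invSelf (mkA (X 0) ^ 2) ∈ φ.range) ?_ ?_ ?_ ?_ hg
    · intro g hg
      simp only [Set.mem_insert_iff, Set.mem_singleton_iff] at hg
      rcases hg with rfl | rfl | rfl | rfl | rfl
      · exact ⟨1, by rw [map_one, hxi]⟩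
      · exact ⟨mkC (X 1), hφX 1⟩
      · exact ⟨mkC (X 2), hφX 2⟩
      · exact ⟨mkC (X 3), hφX 3⟩
      · exact ⟨mkC (X 4), hφX 4⟩
    · rw [map_zero, zero_mul]; exact φ.range.zero_mem
    · intro a b _ _ ha hb
      rw [map_add, add_mul]; exact φ.range.add_mem ha hb
    · intro r a _ ha
      rw [smul_eq_mul, map_mul, mul_assoc]; exact φ.range.mul_mem (hι_mem r) ha
  have hle_range : B ≤ Rφ := Algebra.adjoin_le hgens
  -- (4) the equivalence
  have hsurj : Function.Surjective (φ.codRestrict B.toSubring fun c => hrange_le c) := by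
    intro b
    obtain ⟨c, hc⟩ := (hle_range b.2 : (b : Localization.Away (mkA (X 0) ^ 2)) ∈ φ.range)
    exact ⟨c, Subtype.ext hc⟩
  have hinj' : Function.Injective (φ.codRestrict B.toSubring fun c => hrange_le c) := fun a b h =>
    hinj (congrArg Subtype.val h)
  refine ⟨RingEquiv.ofBijective (φ.codRestrict B.toSubring fun c => hrange_le c) ⟨hinj', hsurj⟩, fun j => ?_⟩
  exact hφX j

/-- Hence the Rees chart ring `A₀[τ/x̄²]` is an integral domain (transport of `C′` being a domain: `F′` is prime, `TauCentreCharts.isPrime_span_chart`). [folklore] -/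
theorem isDomain_blowupAlgebra [CharP k 2] (f : MvPolynomial (Fin 5) k) (hf : f = X 4 ^ 2 + X 0 ^ 4 * X 4 + X 1 ^ 3 + X 2 ^ 3 + X 3 ^ 3) :
    IsDomain (blowupAlgebra (Ideal.span {Ideal.Quotient.mk (Ideal.span {f}) (X 0) ^ 2, Ideal.Quotient.mk (Ideal.span {f}) (X 1),
      Ideal.Quotient.mk (Ideal.span {f}) (X 2), Ideal.Quotient.mk (Ideal.span {f}) (X 3), Ideal.Quotient.mk (Ideal.span {f}) (X 4)} :
        Ideal (MvPolynomial (Fin 5) k ⧸ Ideal.span {f})) (Ideal.Quotient.mk (Ideal.span {f}) (X 0) ^ 2)) := by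
  haveI := TauCentreCharts.isPrime_span_chart k (X 4 ^ 2 + X 0 ^ 2 * X 4 + X 0 ^ 2 * (X 1 ^ 3 + X 2 ^ 3 + X 3 ^ 3)) rfl
  haveI : IsDomain (MvPolynomial (Fin 5) k ⧸ Ideal.span {(X 4 ^ 2 + X 0 ^ 2 * X 4 + X 0 ^ 2 * (X 1 ^ 3 + X 2 ^ 3 + X 3 ^ 3) : MvPolynomial (Fin 5) k)}) :=
    Ideal.Quotient.isDomain _
  obtain ⟨e, -⟩ := exists_chartEquiv k f hf _ rfl
  exact MulEquiv.isDomain _ e.symm.toMulEquiv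

end Summit.ResolutionOfSingularities.ResolutionOfSingularities.Theorems.FInjectiveMacaulayfication.TauFloorOneXChartIdent

end
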